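import Mathlib.NumberTheory.Cyclotomic.Basic
import Literature.NumberTheory.EllipticCurves.Wuthrich2014.ReducibleDivisibilityCyclotomicThree
import Literature.NumberTheory.EllipticCurves.Wuthrich2014.SurjectiveMultiplicativeDivisibility
import Literature.NumberTheory.EllipticCurves.PAdicLFunctionMinusMult
import HarnessLib

/-!
# Kato's divisibility at a NON-SPLIT MULTIPLICATIVE `p = 3` for curves with SURJECTIVE `ρ_{E,3^∞}`,
# read over `K = ℚ(ζ₃)` (Wuthrich 2014, Thm. 3 / Cor. 19, "proven by Kato"; named fact):
# `char_Λ X(E/ℚ(ζ_{3^∞})) ∋ u · L₃(E, ω⁰, T) · L₃(E, ω¹, T)`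

Source, as PUBLISHED: C. Wuthrich, *On the integrality of modular symbols and Kato's Euler system
for elliptic curves*, Doc. Math. 19 (2014) 381–402 [Wuthrich2014]. §1 (journal p. 383, publisher PDF
= EMS Press article file 26230, page text held by the cell at
`run/shared/lean/b2b/bsd-rank1-residual/b2b-bsdres-lit/g8/wuthrich2014/publisher_ems26230/p0003.txt`,
lines 2–25; literature-seat private key `paper:url-8fdc00c72d68`): "Another consequence of Theorem 1
concerns the main conjecture in Iwasawa theory for elliptic curves. **We formulate it here for the full
cyclotomic `ℤ_p^×`-extension.** Theorem 3. Let `E` be an elliptic curve and `p` an odd prime of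
semi-stable reduction. Assume that `E[p]` is reducible as a Galois module over `ℚ`. Then the
characteristic series of the dual of the Selmer group over the cyclotomic extension `ℚ(ζ_{p^∞})`
divides the ideal generated by the `p`-adic `L`-function `L_p(E)` in the Iwasawa algebra
`Λ = ℤ_p⟦Gal(ℚ(ζ_{p^∞})/ℚ)⟧`. Note that our assumptions in the theorem imply that the reduction of
`E` at `p` is ordinary in the sense that `E` has either good ordinary or multiplicative reduction,
because `E[p]` is irreducible when `E` has supersingular reduction, see Proposition 12 in [22]. In
the case when `E` has split multiplicative reduction, we can strengthen our theorem, see Theorem 16.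
**This theorem was proven by Kato in [10] in the case that the reduction is ordinary and the
representation on the Tate module was surjective.**" (p0003.txt L19–L25 for the two "ordinary"
sentences; the hub's older rendering `paper:doi-10-4171-dm-450` is the AUTHOR'S VERSION of
2013-04-23, whose p. 383 reads "proven by Kato in [8] in the case that the representation on the Tate
module was surjective" WITHOUT the "ordinary" clauses — cell literature seat gen 8, same folder,
`README.md` finding 3; this locator answers the referee's nit
`additive-p4-SurjMult-ordinary-parenthetical-unverified`, R116.6); §6 Cor. 19 (p. 398, publisher
text p0018.txt L63–L64: "If `E/ℚ` is a semi-stable elliptic curve and `p` an odd prime where `E` has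
ordinary reduction") and its proof (p. 399): "If `E/ℚ` is a semi-stable elliptic curve and `p` an odd
prime where `E` has ordinary reduction, then `char_Λ X(E)`, or `I char_Λ X(E)` in the split multiplicative case,
divides the ideal generated by `L_p(E)`. Proof. By a theorem of Serre […] the image of `ρ̄_p` is either
the whole of `GL₂(𝔽_p)` or it is contained in a Borel subgroup. In the latter case the representation
`ρ̄_p` is reducible and in the first case the representation `ρ_p : G_ℚ → Aut(T_p E)` is surjective by
another result of Serre unless `p = 3`. Finally for `p = 3` we use the following lemma [Lemma 20] to
exclude that `ρ_p` is not surjective." — i.e. the FIRST CASE of the printed proof derives the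
conclusion from the surjectivity of `ρ_p` on `T_p E` alone, at every odd `p` INCLUDING `p = 3`; §5
(p. 397): `X(E)` = the dual of `lim_n Sel(E/ℚ(ζ_{p^n}))`, "a finitely generated `Λ`-module …
`Λ`-torsion … in general in our situation"; §3 (p. 390): `Λ = ℤ_p⟦G⟧`, `M = ⊕ M_i`; §3.2 (p. 394):
at a non-split multiplicative prime the Coleman map "is injective and has finite cokernel … the same
proof [as Kato Prop. 17.11] also applies"; Cor. 18 (p. 398): `L_p(E) ∈ Λ` for semi-stable `p > 2`.
Torsion over the abelian base `ℚ(ζ₃)`: Greenberg, LNM 1716 Thm. 1.5 (Kato–Rohrlich), PDF p. 61.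
Behind the attribution: Kato, Astérisque 295 (2004) Thm. 12.5 (4) under (12.5.2) (image of
`Gal(ℚ̄/ℚ(ζ_{p^∞}))` contains `SL₂(ℤ_p)`, implied by surjectivity of `ρ_{E,p^∞}` via `det = χ_p`).

ONE NAMED FACT (`def … : Prop`, nothing asserted, D-0014/D-0026): "Kato's theorem as attributed in
Wuthrich Thm. 3 / Cor. 19 (first case of the proof)", NON-SPLIT MULTIPLICATIVE clause at `p = 3` over
the `ℤ₃^×`-extension, read over `K = ℚ(ζ₃)` — the multiplicative sibling of the accepted reading-facts
`Kato2004.charIdeal_dvd_padicLFunction_cyclotomicThree_of_surjective` (p216633, Kato Thm. 17.4 (3) at a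
GOOD ordinary `3`; referee R105.2, flag `Kato-17.4-p3-branch-split`) and, over `ℚ_∞`, of
`kato_charIdeal_dvd_multiplicative_of_surjective` (p181258, flag `Wu14-surj-attribution`). The `K`-reading
is the one given in full in `ReducibleDivisibilityCyclotomicThree` (p206900, flag
`Wu14-Thm16-p3-branch-split`): `ℚ(ζ_{3^∞}) = K_∞`, `X(E) = X(E/K_∞)` = the tree's `SelmerDualData` of a
`K`-model of `E_K`, `Λ(G) = Λ(Γ)e₊ ⊕ Λ(Γ)e₋`, hence `char_{Λ(Γ)} X(E/K_∞) ∋ L₃(E,ω⁰,T)·L₃(E,ω¹,T)`;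
the local type at `3` is that of `ReducibleNonsplitMultiplicativeDivisibilityCyclotomicThree`: even
branch = THE `L` with `IsMultPAdicLFunctionOf f 3 (−1) L` (`a_3 = −1`, no exceptional zero, no factor
`I`), odd branch = `padicLFunctionMinusBranchMult f (−1) 1`. The image hypothesis is spelled, as in
every tree transcription of "the representation on the Tate module is surjective", as
`∀ n, HasSurjectiveModNGaloisRep (3^n)` (equivalent by compactness of the image; it implies (12.5.2)).

Hypotheses transcribed: `E = V` globally minimal over `ℚ`, multiplicative and not split multiplicative
at `3`, `ρ̄_{E,3^n}` onto for every `n`, `K` cyclotomic `{3}` over `ℚ`, `V'` any `K`-model of `E_K`, `κ`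
cyclotomic with topological generator `γ`, `χ₃(γ)·ζ = 4`, `f` the newform of `E`, `D` a dual datum of
`Sel_{3^∞}(E/K_∞)`, the periods `ϖ·Ω_E = Ω⁺_f`, `ϖ'·|Ω⁻(E)| = Ω⁻_f`, and `L` the even branch.
Conclusion: `X(E/K_∞)` is `Λ`-torsion and `u ϖϖ' · L · L⁻₃(f,−1,ω¹,T) = ι g` for some `g ∈ char`,
`u ∈ ℤ₃ˣ`. Proposed flags: `Wu14-surj-attribution` (the surjective case is printed as Thm. 3 + the
attribution sentence and as the first case of the proof of Cor. 19, not as a separately numbered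
theorem) and `Wu14-Thm16-p3-branch-split` (the `Δ = {±1}` reading). What is NOT here: the split clause
and its `I`, `p ≠ 3`, global semistability (Cor. 19's own hypothesis — replaced, as in p181258, by the
surjectivity it is used to produce), any proof.
-- TODO(general form): the statement for every odd `p` over `ℚ(μ_p)` and the split clause with `I`.

Consumer: the BSD rank-≤1 residual cell (`b2b-bsdres`, additive-p4, line V15): the (M)-rows of class
X4 at `p = 3` — `W ≅ V^{(−3)}` additive at `3`, `V` non-split multiplicative at `3`, `W[3]` (hence
`V[3]`) irreducible; `ρ_{V,3^∞}` onto follows in the tree from the census bits surj(3) ∧ ram(3) of `W`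
(`forall_surj_pow_of_twist_pStar_of_surj_of_ram`). HONEST FRAMING: published inputs + kernel
composition only; no label changes; nothing here is "finishing BSD".
-/

set_option autoImplicit false

noncomputable section

open scoped Classical MatrixGroups ModularForm

open CongruenceSubgroup WeierstrassCurve Literature.NumberTheory.EllipticCurves
  Literature.NumberTheory.EllipticCurves.ModularForms
  Literature.NumberTheory.GaloisRepresentations

namespace Literature.NumberTheory.EllipticCurves.Wuthrich2014

/-- **Kato's divisibility at a NON-SPLIT MULTIPLICATIVE `p = 3` under surjective `ρ_{E,3^∞}`, read over
`K = ℚ(ζ₃)` (Wuthrich 2014 Thm. 3 with its attribution sentence, p. 383; Cor. 19, first case of the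
proof, p. 399): `char_{Λ(Γ)} X(E/ℚ(ζ_{3^∞})) ∋ u · L₃(E, ω⁰, T) · L₃(E, ω¹, T)`.** As printed (§1,
p. 383): "We formulate it here for the full cyclotomic `ℤ_p^×`-extension. Theorem 3. Let `E` be an
elliptic curve and `p` an odd prime of semi-stable reduction. Assume that `E[p]` is reducible […]. Then
the characteristic series of the dual of the Selmer group over the cyclotomic extension [divides the
ideal generated by `L_p(E)`]. […] This theorem was proven by Kato in the case that [the reduction is
ordinary and] the representation on the Tate module was surjective."; Cor. 19 proof (p. 399): "in the
first case the representation `ρ_p : G_ℚ → Aut(T_p E)` is surjective […]". `Λ = ℤ_p⟦Gal(ℚ(ζ_{p^∞})/ℚ)⟧`,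
`X(E)` the dual of `lim_n Sel(E/ℚ(ζ_{p^n}))` (§5 p. 397; torsion: loc. cit. and Greenberg LNM 1716
Thm. 1.5 for the abelian base `ℚ(ζ₃)`), `L_p(E) ∈ Λ` (Cor. 18) the Néron-normalised one-term MTT
measure at the multiplicative prime (`ε(p) = 0`, `α = a_p = −1`). For `p = 3`: `ℚ(ζ_{3^∞}) = K_∞`,
`K = ℚ(ζ₃)`, `X(E) = X(E/K_∞)` = the tree's Iwasawa module of any `K`-model `V'` of `E_K` (`κ`
cyclotomic, `χ₃(γ)·ζ = 4`), and `Λ(G) = Λ(Γ)e₊ ⊕ Λ(Γ)e₋` gives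
`char_{Λ(Γ)} X(E/K_∞) ∋ L₃(E,ω⁰,T)·L₃(E,ω¹,T)` (the reading of `charIdeal_dvd_padicLFunction_cyclotomicThree`):
even branch = THE `L` with `IsMultPAdicLFunctionOf f 3 (−1) L`, odd branch =
`padicLFunctionMinusBranchMult f (−1) 1`, periods `ϖ·Ω_E = Ω⁺_f`, `ϖ'·|Ω⁻(E)| = Ω⁻_f`, units in
`u ∈ ℤ₃ˣ`. Image hypothesis spelled `∀ n, HasSurjectiveModNGaloisRep (3^n)` (as in
`kato_charIdeal_dvd_multiplicative_of_surjective`, p181258). Hypotheses: `V` globally minimal,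
multiplicative not split at `3`, `ρ̄_{V,3^n}` onto for all `n`, `K`, `V'`, `κ`, `γ`, `ζ`, `f`, `D`, `ϖ`,
`ϖ'`, `L` as displayed. Conclusion: `D.IsTorsion ∧ ∃ g ∈ char, ∃ u, ι g = C(u ϖ ϖ')·(L · L⁻₃(f,−1,ω¹,T))`.
Named fact; nothing asserted; proposed flags `Wu14-surj-attribution`, `Wu14-Thm16-p3-branch-split`.
**RETIRED as a separate named fact (cell `b2b-bsdres`, referee ruling R120.2, 2026-08-20, endorsing
lit C175 (ii); deprecate-and-add):** this `p = 3` special case is a KERNEL CONSEQUENCE of the odd-`p`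
reading `Wuthrich2014.kato_charIdeal_dvd_nonsplitMultiplicative_cyclotomicPrime_of_surjective`
(`SurjectiveMultiplicativeDivisibilityCyclotomicPrime.lean`) — derivation
`Wuthrich2014.kato_charIdeal_dvd_nonsplitMultiplicative_cyclotomicThree_of_surjective_of_cyclotomicPrime`
(`SurjectiveMultiplicativeDivisibilityCyclotomicThreeOfPrime.lean`, p238280); the cell's class-level
consumers were re-based on the odd-`p` readings in
`Summits/BirchSwinnertonDyer/Rank1Residual/Additive/SemistableTwistRankZeroThreeClassOfPrime.lean`
(p238590). New consumers take the general fact; existing consumers migrate to the `…OfPrime` form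
when next touched; this `def` is kept verbatim only until no module references it, then removed.
[cite: Wuthrich2014, Thm. 3 and §1 (p. 383), Cor. 19 and its proof (pp. 398–399), §5 (p. 397), §3 (p. 390), §3.2 (p. 394), Cor. 18 (p. 398)]
[cite: GreenbergLNM1716, Thm. 1.5 (PDF p. 61)] [cite: Kato2004Asterisque, Thm. 12.5 (4) with (12.5.2) (p. 222)]
[cite: MazurTateTeitelbaum1986Invent, §I.10, §I.13] -/
def kato_charIdeal_dvd_nonsplitMultiplicative_cyclotomicThree_of_surjective : Prop :=
  ∀ (V : WeierstrassCurve ℚ) [V.IsElliptic] [V.IsGloballyMinimal]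
    (K : Type) [Field K] [NumberField K] [IsCyclotomicExtension {3} ℚ K]
    (V' : WeierstrassCurve K) [V'.IsElliptic]
    {κ : ZpExtension K 3} {γ : Field.absoluteGaloisGroup K} {N : ℕ} [NeZero N]
    {f : CuspForm (Gamma0 N) 2},
    V.HasMultiplicativeReductionAtPrime 3 → ¬ V.HasSplitMultiplicativeReductionAtPrime 3 →
    (∀ n : ℕ, V.HasSurjectiveModNGaloisRep (3 ^ n : ℕ)) →
    (∃ C : VariableChange K, C • V.baseChange K = V') →
    κ.IsCyclotomic → κ.IsTopGenerator γ →
    (∃ ζ : ℤ_[3]ˣ, IsOfFinOrder ζ ∧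
      ((GaloisRep.cyclotomicCharacter K 3 γ * ζ : ℤ_[3]ˣ) : ℤ_[3]) =
        (cyclotomicGenerator 3 : ℤ_[3])) →
    IsNewformOf V f →
    ∀ (D : V'.SelmerDualData κ γ) (ϖ ϖ' : ℚ),
      (ϖ : ℝ) * V.realPeriodRat = plusPeriod f →
      (ϖ' : ℝ) * V.imaginaryPeriodRat = minusPeriod f →
    ∀ (L : PowerSeries ℚ_[3]), IsMultPAdicLFunctionOf f 3 (-1) L →
      D.IsTorsion ∧
      ∃ g ∈ D.charIdeal, ∃ u : ℤ_[3]ˣ,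
        iwasawaToPowerSeries 3 g =
          PowerSeries.C (((u : ℤ_[3]) : ℚ_[3]) * (ϖ : ℚ_[3]) * (ϖ' : ℚ_[3])) *
            (L * padicLFunctionMinusBranchMult f (-1 : ℚ_[3]) 1)

end Literature.NumberTheory.EllipticCurves.Wuthrich2014

end
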